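import Summits.CriticalPhenomena.PercolationContinuityZ3.Theorems.PercNearOneGluingNoHeavyRsw3InvasionOutletDensity
import Summits.CriticalPhenomena.PercolationContinuityZ3.Theorems.PercNearOneGluingNoHeavyLowerTailCSHTheoremOne
import HarnessLib

/-!
# RSW3 lane (P2, gen 28): INVASION PERCOLATION XXVI — THE SIZES OF THE INDIVIDUAL PONDS: the law of the cluster swallowed at the `k`-th outlet is
# dominated by a free cluster UNIFORMLY IN `k` (Chayes–Chayes–Newman's Lemma 3.4 as printed); below `p_c(ℤ^d)` the ponds grow at most logarithmically

builds on p205010 (kernel theorem, internal audit signed; external expert review pending) — used ONLY in §3 (`tendsto`/uniform tightness of the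
critical ponds, through `CSH.percolationContinuity_allDimensions`); §1–§2 do not use it.

Cell `prim-rsw3`, prover seat `prim-rsw3-p2` (gen 28), memo `run/shared/lean/prim/rsw3/P2-RSWLITE.md` §35.  Support file
(`--supports stmt-CriticalPhenomena-4575`); no definitions, no named facts, no sorries.  The `k`-th OUTLET (`k = 0, 1, 2, …`) at level `y` is the
step `n` with `M_n(y) = k` and `x_n > y`; the `(k+1)`-st POND is the `y`-cluster `C_y(w)` of the vertex `w` invaded at that step (the `0`-th pond being
`C_y(o)`, gen 27 XIII); it is swallowed whole before the next outlet (gen 26 IX).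

CCN's Lemma 3.4, proof: "`∀ k`, Prob(`s_{k+1} ≥ m`) is bounded above by the probability that the number of occupied bonds attached to a pair of nearest
neighbour sites is at least `m − 1`" — uniformly in `k`, because the `(k+1)`-st cluster is discovered in the complement of the checked bonds.  Kernel form:

* **`labelMeasure_kthPond_ge_le`** (every locally finite graph with countable vertex set, every `y`, `k`, `m`): if `μ{m ≤ |C_y(v)|} ≤ Q` for every vertex
  `v`, then `μ{the pond entered at the k-th outlet has ≥ m vertices} ≤ Q` — sum of the freshness identity `μ(piece ∩ {m ≤ |C^{ext}|}) = μ(piece)·μ{m ≤ |C^{ext}|}`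
  over the (pairwise disjoint) outlet pieces `{I_n = S, w_n = w, x_n > y, M_n = k}`, `(n, S, w) ∈ ℕ × Finset V × V`.
* **`labelMeasure_kthPond_ge_le_exp_of_lt_criticalProb`** (`ℤ^d`, `d ≥ 2`, `0 < y < p_c`): `≤ A e^{−λ m}` uniformly in `k`.
* **`ae_eventually_kthPond_lt_log_of_lt_criticalProb`** (`ℤ^d`, `y < p_c`, `0 < y`): `∃ C`, almost surely, for all large `k`, the pond entered at the
  `k`-th outlet has fewer than `C·log(k + 2)` vertices — **BELOW `p_c` THE PONDS GROW AT MOST LOGARITHMICALLY** (Borel–Cantelli), in contrast with the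
  level `p_c`, where already the first pond `C_{p_c}(0)` has infinite mean (gen 27 XIII) and the average pond size diverges (gen 27 XI).
* **`labelMeasure_real_kthPond_ge_criticalProb_le`** (`ℤ^d`, every `k`, `m`, no p205010): AT `p_c` the `k`-th pond is dominated by `|C_{p_c}(0)|`:
  `μ{k-th critical pond ≥ m} ≤ P_{p_c}(|C(0)| ≥ m)`; **`forall_eventually_labelMeasure_real_kthPond_ge_criticalProb_le`** (p205010): the critical ponds are
  UNIFORMLY TIGHT — `∀ ε > 0`, for all large `m`, `μ{k-th critical pond ≥ m} ≤ ε` for EVERY `k` (`P_{p_c}(|C| ≥ m) → θ(p_c) = 0`).  The ponds of the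
  critical invasion do not grow in law, although their mean is infinite from the first one on.
* `coe_invasion_eq_union_openCluster_of_consecutive_outlets`, **`encard_openCluster_eq_sub_of_consecutive_outlets`** (every infinite connected
  locally finite graph): between consecutive outlets `n < n'` exactly the pond `C_y(w_n)` is swallowed: `I_{n'} = I_n ⊔ C_y(w_n)` and `|C_y(w_n)| = n' − n`
  — the pond volumes ARE the inter-outlet times; hence `ae_eventually_interOutlet_lt_log_of_lt_criticalProb`: below `p_c(ℤ^d)` the inter-outlet times
  are `< ⌈C log(k+2)⌉` for all large `k`, almost surely.

References: J. T. Chayes, L. Chayes, C. M. Newman, Comm. Math. Phys. 101 (1985) 383–407, Lemma 3.4 (proof, (3.20)) [ChayesChayesNewman1985].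
-/

noncomputable section

namespace Summit.CriticalPhenomena.PercolationContinuityZ3.Theorems.Rsw3

open Finset MeasureTheory Filter Topology Literature.Probability.Percolation Literature.Probability.Percolation.Invasion
open scoped ENNReal

/-! ## §1 The law of the `k`-th pond is dominated by a free cluster, uniformly in `k` (every graph) -/

section General

variable {V : Type*} [DecidableEq V] {G : SimpleGraph V} [G.LocallyFinite] [Countable V]

/-- **CCN's LEMMA 3.4 (uniform domination of the swallowed clusters)**: on a locally finite graph with countable vertex set, for every level `y`,
every `k` and `m`: if `μ{m ≤ |C_y(v)|} ≤ Q` for all vertices `v`, then the probability that the pond entered at the `k`-th outlet has at least `m`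
vertices is at most `Q`.  (Decompose along the outlet pieces `{I_n = S, w_n = w, x_n > y, M_n(y) = k}`, pairwise disjoint over `(n, S, w)`; on each, the
pond is the exterior cluster `C^{ext,S}_y(w)` (file XXI), independent of the piece (gen 26) and dominated by `C_y(w)`.)
[cite: ChayesChayesNewman1985, Lemma 3.4 (proof: "∀k, Prob(s_{k+1} ≥ m) is bounded above by …")] -/
theorem labelMeasure_kthPond_ge_le (o : V) (y : ℝ) (k m : ℕ) {Q : ℝ≥0∞}
    (hQ : ∀ v : V, labelMeasure V {U : Sym2 V → ℝ | (m : ℕ∞) ≤ (openCluster (configOfLabels y U G) v).encard} ≤ Q) :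
    labelMeasure V {U : Sym2 V → ℝ | ∃ n, badCount G U o y n = k ∧ y < acceptedLabel G U o n ∧
        ∃ a, newDart G U (invasion G U o n) = some a ∧ (m : ℕ∞) ≤ (openCluster (configOfLabels y U G) a.2).encard} ≤ Q := by
  haveI : IsProbabilityMeasure (labelMeasure V) := isProbabilityMeasure_labelMeasure _
  -- the pieces and the exterior events, indexed by `(n, S, w)`
  set A : ℕ × Finset V × V → Set (Sym2 V → ℝ) := fun i =>
    {U | invasion G U o i.1 = i.2.1 ∧ (∃ z, newDart G U i.2.1 = some (z, i.2.2)) ∧ y < acceptedLabel G U o i.1 ∧ badCount G U o y i.1 = k}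
    with hA
  set B : ℕ × Finset V × V → Set (Sym2 V → ℝ) := fun i =>
    {U | (m : ℕ∞) ≤ (openCluster (configOfLabels y U (G.deleteEdges {e | ∃ x ∈ i.2.1, x ∈ e})) i.2.2).encard} with hB
  have hAm : ∀ i, MeasurableSet (A i) := fun i => measurableSet_outletPiece o i.1 i.2.1 i.2.2 y k
  have hBm : ∀ i, MeasurableSet (B i) := fun i => measurableSet_le_encard_exteriorCluster (G := G) y i.2.1 i.2.2 m
  -- the event is covered by the pieces
  have hsub : {U : Sym2 V → ℝ | ∃ n, badCount G U o y n = k ∧ y < acceptedLabel G U o n ∧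
      ∃ a, newDart G U (invasion G U o n) = some a ∧ (m : ℕ∞) ≤ (openCluster (configOfLabels y U G) a.2).encard}
      ⊆ ⋃ i, (A i ∩ B i) := by
    rintro U ⟨n, hk, hout, a, ha, hm⟩
    refine Set.mem_iUnion.2 ⟨(n, invasion G U o n, a.2), ⟨rfl, ⟨a.1, ha⟩, hout, hk⟩, ?_⟩
    show (m : ℕ∞) ≤ (openCluster (configOfLabels y U (G.deleteEdges {e | ∃ x ∈ invasion G U o n, x ∈ e})) a.2).encard
    rwa [← openCluster_configOfLabels_eq_exterior_of_outlet ha hout]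
  -- the pieces are pairwise disjoint
  have hdisj : Pairwise (Function.onFun Disjoint A) := by
    intro i j hij
    rw [Function.onFun, Set.disjoint_left]
    rintro U ⟨hIi, ⟨zi, hzi⟩, houti, hki⟩ ⟨hIj, ⟨zj, hzj⟩, houtj, hkj⟩
    apply hij
    -- same time: an outlet at time `n` raises the count, so `M_n = k` pins down `n`
    have hn : i.1 = j.1 := by
      by_contra hne
      rcases Nat.lt_or_gt_of_ne hne with hlt | hlt
      · have h1 : badCount G U o y (i.1 + 1) ≤ badCount G U o y j.1 := badCount_mono G U o y hlt
        rw [badCount_succ, if_pos houti, hki, hkj] at h1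
        omega
      · have h1 : badCount G U o y (j.1 + 1) ≤ badCount G U o y i.1 := badCount_mono G U o y hlt
        rw [badCount_succ, if_pos houtj, hki, hkj] at h1
        omega
    have hS : i.2.1 = j.2.1 := by rw [← hIi, ← hIj, hn]
    have hw : i.2.2 = j.2.2 := by
      rw [← hS] at hzj
      exact (Prod.mk.inj (Option.some.inj (hzi.symm.trans hzj))).2
    exact Prod.ext hn (Prod.ext hS hw)
  calc labelMeasure V {U : Sym2 V → ℝ | ∃ n, badCount G U o y n = k ∧ y < acceptedLabel G U o n ∧
          ∃ a, newDart G U (invasion G U o n) = some a ∧ (m : ℕ∞) ≤ (openCluster (configOfLabels y U G) a.2).encard}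
      ≤ labelMeasure V (⋃ i, (A i ∩ B i)) := measure_mono hsub
    _ ≤ ∑' i, labelMeasure V (A i ∩ B i) := measure_iUnion_le _
    _ = ∑' i, labelMeasure V (A i) * labelMeasure V (B i) := by
        refine tsum_congr fun i => ?_
        exact labelMeasure_inter_eq_mul i.2.1 (hAm i) (hBm i)
          (fun U U' h => outletPiece_iff_of_agree o i.1 i.2.1 i.2.2 y k U U' h)
          (fun U U' h => le_encard_exteriorCluster_iff_of_agree_off (G := G) y i.2.1 i.2.2 m U U' h)
    _ ≤ ∑' i, labelMeasure V (A i) * Q := by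
        refine ENNReal.tsum_le_tsum fun i => mul_le_mul' le_rfl ?_
        exact (measure_mono (setOf_le_encard_exteriorCluster_subset (G := G) y i.2.1 i.2.2 m)).trans (hQ i.2.2)
    _ = (∑' i, labelMeasure V (A i)) * Q := ENNReal.tsum_mul_right
    _ = labelMeasure V (⋃ i, A i) * Q := by rw [measure_iUnion hdisj hAm]
    _ ≤ 1 * Q := mul_le_mul' prob_le_one le_rfl
    _ = Q := one_mul _

end General

/-! ## §2 `ℤ^d` below `p_c`: uniformly exponential pond tails, logarithmic pond growth -/

section Zd

open Literature.Probability.LatticeModels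

variable {d : ℕ}

/-- **The `k`-th pond below `p_c(ℤ^d)` has a uniformly exponential tail**: for `d ≥ 2`, `0 < y < p_c` there are `A ≥ 0`, `λ > 0` with
`μ{the pond entered at the k-th outlet has ≥ m vertices} ≤ A e^{−λm}` for ALL `k` and `m ≥ 1` (§1 with the subcritical volume tail of file XXV).
[cite: ChayesChayesNewman1985, Lemma 3.4 (proof)] -/
theorem labelMeasure_kthPond_ge_le_exp_of_lt_criticalProb (hd : 2 ≤ d) {y : ℝ} (hy0 : 0 < y) (hy : y < criticalProb (zdGraph d) (0 : Site d)) :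
    ∃ A lam : ℝ, 0 ≤ A ∧ 0 < lam ∧ ∀ k m : ℕ, 1 ≤ m →
      (labelMeasure (Site d)).real {U : Sym2 (Site d) → ℝ | ∃ n, badCount (zdGraph d) U 0 y n = k ∧ y < acceptedLabel (zdGraph d) U 0 n ∧
          ∃ a, newDart (zdGraph d) U (invasion (zdGraph d) U 0 n) = some a ∧
            (m : ℕ∞) ≤ (openCluster (configOfLabels y U (zdGraph d)) a.2).encard} ≤ A * Real.exp (-(lam * m)) := by
  haveI : IsProbabilityMeasure (labelMeasure (Site d)) := isProbabilityMeasure_labelMeasure _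
  obtain ⟨A, lam, hA, hlam, htail⟩ := exists_exp_tail_labelMeasure_of_lt_criticalProb hd hy0 hy
  refine ⟨A, lam, hA, hlam, fun k m hm => ?_⟩
  have hQ : ∀ v : Site d, labelMeasure (Site d) {U : Sym2 (Site d) → ℝ |
      (m : ℕ∞) ≤ (openCluster (configOfLabels y U (zdGraph d)) v).encard} ≤ ENNReal.ofReal (A * Real.exp (-(lam * m))) := by
    intro v
    rw [← ofReal_measureReal (measure_ne_top _ _)]
    exact ENNReal.ofReal_le_ofReal (htail v m hm)
  have h := labelMeasure_kthPond_ge_le (G := zdGraph d) (0 : Site d) y k m hQ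
  rw [measureReal_def]
  exact (ENNReal.toReal_mono ENNReal.ofReal_ne_top h).trans (by rw [ENNReal.toReal_ofReal (by positivity)])

/-- **BELOW `p_c` THE PONDS GROW AT MOST LOGARITHMICALLY**: for `d ≥ 2` and `0 < y < p_c(ℤ^d)` there is `C` such that, almost surely, for all large
`k`, the pond entered at the `k`-th outlet has fewer than `⌈C·log(k + 2)⌉` vertices (Borel–Cantelli on the uniform tail with `C = 2/λ`: the bad
probabilities are `≤ A (k+2)^{−2}`).  At `p_c` instead the very first pond has infinite mean (gen 27 XIII).
[cite: ChayesChayesNewman1985, Lemma 3.4] -/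
theorem ae_eventually_kthPond_lt_log_of_lt_criticalProb (hd : 2 ≤ d) {y : ℝ} (hy0 : 0 < y)
    (hy : y < criticalProb (zdGraph d) (0 : Site d)) :
    ∃ C : ℝ, ∀ᵐ U ∂(labelMeasure (Site d)), ∀ᶠ k : ℕ in atTop, ∀ n : ℕ,
      badCount (zdGraph d) U 0 y n = k → y < acceptedLabel (zdGraph d) U 0 n →
        ∀ a, newDart (zdGraph d) U (invasion (zdGraph d) U 0 n) = some a →
          (openCluster (configOfLabels y U (zdGraph d)) a.2).encard < (⌈C * Real.log ((k : ℝ) + 2)⌉₊ : ℕ∞) := by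
  haveI : IsProbabilityMeasure (labelMeasure (Site d)) := isProbabilityMeasure_labelMeasure _
  obtain ⟨A, lam, hA, hlam, htail⟩ := labelMeasure_kthPond_ge_le_exp_of_lt_criticalProb hd hy0 hy
  refine ⟨2 / lam, ?_⟩
  set mk : ℕ → ℕ := fun k => ⌈2 / lam * Real.log ((k : ℝ) + 2)⌉₊ with hmk
  have hlog : ∀ k : ℕ, 0 < Real.log ((k : ℝ) + 2) := fun k => Real.log_pos (by have := (Nat.cast_nonneg k : (0:ℝ) ≤ k); linarith)
  have hmk1 : ∀ k, 1 ≤ mk k := fun k => Nat.one_le_iff_ne_zero.2 (by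
    rw [hmk]; exact Nat.ne_of_gt (Nat.ceil_pos.2 (mul_pos (by positivity) (hlog k))))
  set Bad : ℕ → Set (Sym2 (Site d) → ℝ) := fun k =>
    {U | ∃ n, badCount (zdGraph d) U 0 y n = k ∧ y < acceptedLabel (zdGraph d) U 0 n ∧
      ∃ a, newDart (zdGraph d) U (invasion (zdGraph d) U 0 n) = some a ∧
        ((mk k : ℕ) : ℕ∞) ≤ (openCluster (configOfLabels y U (zdGraph d)) a.2).encard} with hBad
  have hbound : ∀ k : ℕ, labelMeasure (Site d) (Bad k) ≤ ENNReal.ofReal (A * (1 / ((k : ℝ) + 2) ^ 2)) := by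
    intro k
    rw [← ofReal_measureReal (measure_ne_top _ _)]
    refine ENNReal.ofReal_le_ofReal ((htail k (mk k) (hmk1 k)).trans ?_)
    refine mul_le_mul_of_nonneg_left ?_ hA
    have hceil : 2 / lam * Real.log ((k : ℝ) + 2) ≤ (mk k : ℝ) := Nat.le_ceil _
    have hk2 : (0 : ℝ) < (k : ℝ) + 2 := by positivity
    calc Real.exp (-(lam * (mk k : ℝ))) ≤ Real.exp (-(lam * (2 / lam * Real.log ((k : ℝ) + 2)))) := by
          apply Real.exp_le_exp.2; nlinarith
      _ = 1 / ((k : ℝ) + 2) ^ 2 := by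
          rw [show lam * (2 / lam * Real.log ((k : ℝ) + 2)) = (2 : ℕ) * Real.log ((k : ℝ) + 2) by field_simp; ring,
            Real.exp_neg, Real.exp_nat_mul, Real.exp_log hk2, one_div]
  have hsum : ∑' k, labelMeasure (Site d) (Bad k) ≠ ∞ := by
    have hs : Summable fun k : ℕ => A * (1 / ((k : ℝ) + 2) ^ 2) := by
      have h1 : Summable fun k : ℕ => 1 / (((k + 2 : ℕ) : ℝ)) ^ 2 :=
        (summable_nat_add_iff 2).2 (Real.summable_one_div_nat_pow.2 one_lt_two)
      refine (h1.mul_left A).congr fun k => ?_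
      push_cast; ring
    refine ne_top_of_le_ne_top ?_ (ENNReal.tsum_le_tsum hbound)
    rw [← ENNReal.ofReal_tsum_of_nonneg (fun k => by positivity) hs]
    exact ENNReal.ofReal_ne_top
  filter_upwards [ae_eventually_notMem hsum] with U hU
  filter_upwards [hU] with k hk n hnk hout a ha
  simp only [hBad, Set.mem_setOf_eq, not_exists, not_and, not_le] at hk
  exact hk n hnk hout a ha

/-! ## §3 At `p_c(ℤ^d)`: every pond is dominated by `|C_{p_c}(0)|`; uniform tightness from `θ(p_c) = 0` (p205010) -/

/-- **AT `p_c` THE `k`-TH POND IS DOMINATED BY THE CRITICAL CLUSTER OF THE ORIGIN, uniformly in `k`** (`ℤ^d`, `d ≥ 1`, no continuity input):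
`μ{the pond entered at the k-th outlet at level p_c has ≥ m vertices} ≤ P_{p_c}(|C(0)| ≥ m)`. [cite: ChayesChayesNewman1985, Lemma 3.4 (proof)] -/
theorem labelMeasure_real_kthPond_ge_criticalProb_le (k m : ℕ) :
    (labelMeasure (Site d)).real {U : Sym2 (Site d) → ℝ | ∃ n,
        badCount (zdGraph d) U 0 (criticalProb (zdGraph d) (0 : Site d)) n = k ∧
          criticalProb (zdGraph d) (0 : Site d) < acceptedLabel (zdGraph d) U 0 n ∧
          ∃ a, newDart (zdGraph d) U (invasion (zdGraph d) U 0 n) = some a ∧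
            (m : ℕ∞) ≤ (openCluster (configOfLabels (criticalProb (zdGraph d) (0 : Site d)) U (zdGraph d)) a.2).encard}
      ≤ (bondPercolation (zdGraph d) (criticalProbI d)).real (clusterSizeGe (0 : Site d) m) := by
  haveI : IsProbabilityMeasure (labelMeasure (Site d)) := isProbabilityMeasure_labelMeasure _
  have hQ : ∀ v : Site d, labelMeasure (Site d) {U : Sym2 (Site d) → ℝ |
      (m : ℕ∞) ≤ (openCluster (configOfLabels (criticalProb (zdGraph d) (0 : Site d)) U (zdGraph d)) v).encard}
      ≤ bondPercolation (zdGraph d) (criticalProbI d) (clusterSizeGe (0 : Site d) m) := by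
    intro v
    rw [← coe_criticalProbI, labelMeasure_setOf_le_encard_openCluster (criticalProbI d) v m, ← ofReal_measureReal (measure_ne_top _ _),
      ← ofReal_measureReal (measure_ne_top _ _), Literature.Barriers.CriticalPhenomena.real_clusterSizeGe_eq_zero]
  have h := labelMeasure_kthPond_ge_le (G := zdGraph d) (0 : Site d) (criticalProb (zdGraph d) (0 : Site d)) k m hQ
  rw [measureReal_def, measureReal_def]
  exact ENNReal.toReal_mono (measure_ne_top _ _) h

/-- **THE CRITICAL PONDS ARE UNIFORMLY TIGHT** (`ℤ^d`, `d ≥ 2`, p205010): for every `ε > 0`, for all large `m`, the pond entered at the `k`-th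
outlet at level `p_c` has `≥ m` vertices with probability `≤ ε`, SIMULTANEOUSLY FOR ALL `k` — `P_{p_c}(|C(0)| ≥ m) ↓ θ(p_c) = 0`.  (Each critical
pond has infinite mean — gen 27 XIII for the first — yet their laws do not drift to `+∞`.)
[cite: ChayesChayesNewman1985, Lemma 3.4 (proof) and Thm 5.2 (with P_∞(p_c) = 0)] -/
theorem forall_eventually_labelMeasure_real_kthPond_ge_criticalProb_le (hd : 2 ≤ d) {ε : ℝ} (hε : 0 < ε) :
    ∀ᶠ m : ℕ in atTop, ∀ k : ℕ,
      (labelMeasure (Site d)).real {U : Sym2 (Site d) → ℝ | ∃ n,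
        badCount (zdGraph d) U 0 (criticalProb (zdGraph d) (0 : Site d)) n = k ∧
          criticalProb (zdGraph d) (0 : Site d) < acceptedLabel (zdGraph d) U 0 n ∧
          ∃ a, newDart (zdGraph d) U (invasion (zdGraph d) U 0 n) = some a ∧
            (m : ℕ∞) ≤ (openCluster (configOfLabels (criticalProb (zdGraph d) (0 : Site d)) U (zdGraph d)) a.2).encard} ≤ ε := by
  have hθ : theta (zdGraph d) (0 : Site d) (criticalProbI d) = 0 := CSH.percolationContinuity_allDimensions d hd
  have hlim := tendsto_real_clusterSizeGe (zdGraph d) (0 : Site d) (criticalProbI d)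
  rw [hθ] at hlim
  filter_upwards [(tendsto_order.1 hlim).2 ε hε] with m hm k
  exact (labelMeasure_real_kthPond_ge_criticalProb_le k m).trans hm.le

end Zd

/-! ## §4 The pond is swallowed exactly between consecutive outlets (every graph) -/

section Excursion

variable {V : Type*} [DecidableEq V] {G : SimpleGraph V} [G.LocallyFinite]

/-- Along a stretch without outlets the pond closure does not move: if `x_i ≤ y` for all `n < i < n + j`... precisely, for all `i` with
`n + 1 ≤ i < n + 1 + j`, then `P_{n+1+j} = P_{n+1}`. [cite: ChayesChayesNewman1985, §3 (ii)] -/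
theorem pondClosure_eq_of_forall_not_outlet [Infinite V] (hG : G.Preconnected) {U : Sym2 V → ℝ} {o : V} {y : ℝ} {n j : ℕ}
    (h : ∀ i, n ≤ i → i < n + j → acceptedLabel G U o i ≤ y) :
    (⋃ v ∈ invasion G U o (n + j), openCluster (configOfLabels y U G) v)
      = ⋃ v ∈ invasion G U o n, openCluster (configOfLabels y U G) v := by
  induction j with
  | zero => rfl
  | succ j ih =>
    have hj : ∀ i, n ≤ i → i < n + j → acceptedLabel G U o i ≤ y := fun i h1 h2 => h i h1 (by omega)
    rw [← ih hj, ← add_assoc]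
    obtain ⟨a, ha⟩ := exists_newDart_eq_some (U := U) (boundaryDarts_invasion_nonempty hG U o (n + j))
    have hle : U s(a.1, a.2) ≤ y := by rw [← acceptedLabel_of_eq_some G ha]; exact h (n + j) (by omega) (by omega)
    exact pondClosure_succ_eq_of_not_outlet ha hle

/-- **THE POND ENTERED AT AN OUTLET IS SWALLOWED EXACTLY BY THE NEXT OUTLET** (infinite connected locally finite graph): if `n < n'` are consecutive
outlets at level `y` (`x_n > y`, `x_{n'} > y`, `x_i ≤ y` in between) and `w` is the vertex invaded at step `n`, then `I_{n'} = I_n ∪ C_y(w)`.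
[cite: ChayesChayesNewman1985, §3 (ii) (the stopping times n_k) and Lemma 3.4 eq. (3.18)] -/
theorem coe_invasion_eq_union_openCluster_of_consecutive_outlets [Infinite V] (hG : G.Preconnected) {U : Sym2 V → ℝ} {o : V} {y : ℝ}
    {n n' : ℕ} {a : V × V} (ha : newDart G U (invasion G U o n) = some a) (hn : y < acceptedLabel G U o n) (hnn' : n < n')
    (hn' : y < acceptedLabel G U o n') (hbetween : ∀ i, n < i → i < n' → acceptedLabel G U o i ≤ y) :
    (↑(invasion G U o n') : Set V) = ↑(invasion G U o n) ∪ openCluster (configOfLabels y U G) a.2 := by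
  obtain ⟨j, rfl⟩ : ∃ j, n' = n + 1 + j := ⟨n' - (n + 1), by omega⟩
  have hP : (⋃ v ∈ invasion G U o (n + 1 + j), openCluster (configOfLabels y U G) v)
      = ⋃ v ∈ invasion G U o (n + 1), openCluster (configOfLabels y U G) v :=
    pondClosure_eq_of_forall_not_outlet hG fun i h1 h2 => hbetween i (by omega) (by omega)
  rw [← pondClosure_eq_coe_of_outlet hn', hP, pondClosure_succ_eq_of_outlet ha hn, ← openCluster_configOfLabels_eq_exterior_of_outlet ha hn]

/-- **… and its volume is the inter-outlet time**: under the same hypotheses `|C_y(w)| = n' − n` (the pond is disjoint from `I_n`, and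
`|I_{n'}| = n' + 1`, `|I_n| = n + 1`). [cite: ChayesChayesNewman1985, Lemma 3.4 eq. (3.18) ("L_{n_{k+1}} − L_{n_k} ≤ the size of the (k+1)-st cluster absorbed + …")] -/
theorem encard_openCluster_eq_sub_of_consecutive_outlets [Infinite V] (hG : G.Preconnected) {U : Sym2 V → ℝ} {o : V} {y : ℝ}
    {n n' : ℕ} {a : V × V} (ha : newDart G U (invasion G U o n) = some a) (hn : y < acceptedLabel G U o n) (hnn' : n < n')
    (hn' : y < acceptedLabel G U o n') (hbetween : ∀ i, n < i → i < n' → acceptedLabel G U o i ≤ y) :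
    (openCluster (configOfLabels y U G) a.2).encard = ((n' - n : ℕ) : ℕ∞) := by
  have hunion := coe_invasion_eq_union_openCluster_of_consecutive_outlets hG ha hn hnn' hn' hbetween
  -- the pond is disjoint from the closed region `I_n`
  have hdisj : Disjoint (↑(invasion G U o n) : Set V) (openCluster (configOfLabels y U G) a.2) := by
    rw [Set.disjoint_left]
    intro v hv hvw
    have hwv : a.2 ∈ openCluster (configOfLabels y U G) v := (hvw : (openGraph _).Reachable a.2 v).symm
    exact snd_not_mem_of_newDart ha (Finset.mem_coe.1 (openCluster_subset_coe_invasion_of_outlet hn (Finset.mem_coe.1 hv) hwv))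
  have hcard : ((n' + 1 : ℕ) : ℕ∞) = ((n + 1 : ℕ) : ℕ∞) + (openCluster (configOfLabels y U G) a.2).encard := by
    rw [← card_invasion hG U o n', ← Set.encard_coe_eq_coe_finsetCard, hunion, Set.encard_union_eq hdisj,
      Set.encard_coe_eq_coe_finsetCard, card_invasion hG U o n]
  have hfin : (openCluster (configOfLabels y U G) a.2).encard ≠ ⊤ := by
    intro htop; rw [htop, add_top] at hcard; exact ENat.coe_ne_top _ hcard
  obtain ⟨s, hs⟩ := ENat.ne_top_iff_exists.1 hfin
  rw [← hs] at hcard ⊢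
  have : n' + 1 = n + 1 + s := by exact_mod_cast hcard
  congr 1; omega

/-- **BELOW `p_c(ℤ^d)` THE INTER-OUTLET TIMES ARE LOGARITHMIC**: for `d ≥ 2` and `0 < y < p_c` there is `C` such that, almost surely, for all large `k`:
if `n < n'` are the `k`-th and the next outlet at level `y`, then `n' − n < ⌈C·log(k + 2)⌉` (the pond swallowed in between has exactly `n' − n` vertices,
and ponds grow at most logarithmically, §2). [cite: ChayesChayesNewman1985, Lemma 3.4 ((L_{n_{k+1}} − L_{n_k})/k → 0)] -/
theorem ae_eventually_interOutlet_lt_log_of_lt_criticalProb {d : ℕ} (hd : 2 ≤ d) {y : ℝ} (hy0 : 0 < y)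
    (hy : y < criticalProb (Literature.Probability.LatticeModels.zdGraph d) (0 : Literature.Probability.LatticeModels.Site d)) :
    ∃ C : ℝ, ∀ᵐ U ∂(labelMeasure (Literature.Probability.LatticeModels.Site d)), ∀ᶠ k : ℕ in atTop, ∀ n n' : ℕ,
      badCount (Literature.Probability.LatticeModels.zdGraph d) U 0 y n = k →
        y < acceptedLabel (Literature.Probability.LatticeModels.zdGraph d) U 0 n → n < n' →
        y < acceptedLabel (Literature.Probability.LatticeModels.zdGraph d) U 0 n' →
        (∀ i, n < i → i < n' → acceptedLabel (Literature.Probability.LatticeModels.zdGraph d) U 0 i ≤ y) →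
          n' - n < ⌈C * Real.log ((k : ℝ) + 2)⌉₊ := by
  open Literature.Probability.LatticeModels in
  haveI : Nonempty (Fin d) := ⟨⟨0, by omega⟩⟩
  haveI : Infinite (Site d) := Pi.infinite_of_right
  obtain ⟨C, hC⟩ := ae_eventually_kthPond_lt_log_of_lt_criticalProb hd hy0 hy
  refine ⟨C, ?_⟩
  filter_upwards [hC] with U hU
  filter_upwards [hU] with k hk n n' hnk hout hnn' hout' hbetween
  obtain ⟨a, ha⟩ := exists_newDart_eq_some (U := U) (boundaryDarts_invasion_nonempty zdGraph_preconnected_holds U 0 n)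
  have hlt := hk n hnk hout a ha
  rw [encard_openCluster_eq_sub_of_consecutive_outlets zdGraph_preconnected_holds ha hout hnn' hout' hbetween] at hlt
  exact_mod_cast hlt

end Excursion


end Summit.CriticalPhenomena.PercolationContinuityZ3.Theorems.Rsw3

end
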